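import Mathlib.Analysis.Fourier.FourierTransformDeriv
import Mathlib.Analysis.Fourier.PoissonSummation
import Mathlib.Analysis.SpecialFunctions.Pow.Deriv
import Mathlib.Analysis.Calculus.IteratedDeriv.Lemmas
import Mathlib.MeasureTheory.Function.JacobianOneDim
import HarnessLib

/-!
# Non-stationary phase and Poisson summation for `h_t(u) = w(u)² u^{it}` (Guth–Maynard §4, Lemma 4.3)

Topic `NumberTheory/LFunctions`, family RH. The files `ZeroDensityGuthMaynardWindow.lean`,
`LargeValuesGuthMaynardReduction.lean` and `LargeValuesTraceMethod.lean` reduce the tree's named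
fact `Literature.NumberTheory.LFunctions.zeroDensity_guth_maynard` (Guth–Maynard, Theorem 1.2) to
Proposition 3.1 of L. Guth, J. Maynard, *New large value estimates for Dirichlet polynomials*,
Ann. of Math. 203 (2026), and prove the entry lemmas 4.1–4.2 of its proof (large values are
controlled by `tr(G)` and `tr(G³)` for the Gram matrix `G_{t₁,t₂} = ∑_n w(n/N)² n^{i(t₁−t₂)}`).
This file PROVES the next two ingredients of §4 of the paper, for an arbitrary smooth weight
`w : ℝ → ℝ` supported in `[1, 2]` (the paper fixes one such `w`, equal to `1` on `[6/5, 9/5]`):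

* **Lemma 4.3 (Non-stationary phase)** for `h_t(u) := w(u)² u^{it}` (eq. (4.3) of the paper):
  `|ĥ_t(ξ)| ≪_j (1+|t|)^j / |ξ|^j` (`norm_fourier_hFun_le_pow_div`) and
  `|ĥ_t(ξ)| ≪_j (1+|ξ|)^j / |t|^j` (`norm_fourier_hFun_le_pow_div'`), for every `j ≥ 0`, with the
  trivial bound `|ĥ_t(ξ)| ≪ 1` (`norm_fourier_hFun_le`). Here `ĥ = 𝓕 h` is Mathlib's Fourier
  transform `𝓕 f (ξ) = ∫ f(u) e(−ξu) du`, the paper's normalisation.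
* **Poisson summation for the Gram-matrix entries** (the first step of the proofs of Lemmas 4.4
  and 4.5): `∑_{N ≤ n ≤ 2N} w(n/N)² n^{it} = N^{1+it} ∑_{m ∈ ℤ} ĥ_t(Nm)`
  (`sum_weight_sq_cpow_eq`, with `summable_fourier_hFun`), from Mathlib's
  `Real.tsum_eq_tsum_fourier_of_rpow_decay` and the first bound of Lemma 4.3 with `j = 2`.

Proof of Lemma 4.3: the first bound is `j`-fold integration by parts in the Fourier integral
(Mathlib's `Real.fourier_iteratedDeriv`, `𝓕(f^{(j)})(ξ) = (2πiξ)^j f̂(ξ)`) together with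
`‖h_t^{(j)}‖_∞ ≪_j (1+|t|)^j` (`norm_iteratedDeriv_hFun_le`: Leibniz rule and
`(d/du)^k u^{it} = it(it−1)⋯(it−k+1)u^{it−k}`); for the second bound the paper integrates by parts
against `u^{it}`; equivalently (as done here) one substitutes `u = e^v`, after which
`ĥ_t(ξ) = ∫ e^v w(e^v)² e(−ξe^v) e^{itv} dv` is a Fourier integral in `v` at frequency `−t/(2π)` of a
smooth function supported in `[0, log 2]` whose `v`-derivatives are `≪_j (1+|ξ|)^j`
(`fourier_hFun_eq_fourier_expWeight`, `norm_iteratedDeriv_expWeight_mul_le`).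

Definitions (with bodies; no named fact is introduced, everything in this file is proved):
`GuthMaynardFourier.ePow s u = exp(s log u)` (`= u^s` for `u > 0`, `ePow_eq_cpow`),
`GuthMaynardFourier.hFun w t = h_t` (`hFun_apply_of_pos`: `h_t(u) = w(u)² u^{it}` for `u > 0`; we
use the real logarithm so that `h_t` is globally smooth, `hFun_contDiff`), `wSq`, `expWeight`,
`phaseCoeff`, `expPhase` (the data of the substitution `u = e^v`).

## References

* L. Guth, J. Maynard, *New large value estimates for Dirichlet polynomials*, Ann. of Math. (2)
  203 (2026), no. 2; arXiv:2405.20552 (2024): §4, eq. (4.3), Lemma 4.3 and its proof; proofs of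
  Lemmas 4.4–4.5 (Poisson summation step).
-/

noncomputable section

open Real Set Filter Topology Complex MeasureTheory Finset
open scoped FourierTransform ContDiff

namespace Literature.NumberTheory.LFunctions

namespace GuthMaynardFourier

/-! ## §1. `u ↦ u^s = exp(s log u)` on `u > 0` and its derivatives -/

/-- `ePow s u = exp(s · log u)`; for `u > 0` this is `u^s` (`ePow_eq_cpow`). We use the real
logarithm so that `ePow s` is smooth on `u ≠ 0`. [folklore] -/
def ePow (s : ℂ) (u : ℝ) : ℂ := Complex.exp ((Real.log u : ℂ) * s)

/-- `ePow s u = u^s` for `u > 0`. [folklore] -/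
theorem ePow_eq_cpow {u : ℝ} (hu : 0 < u) (s : ℂ) : ePow s u = (u : ℂ) ^ s := by
  rw [ePow, Complex.cpow_def_of_ne_zero (by exact_mod_cast hu.ne'), Complex.ofReal_log hu.le]

/-- `|u^s| = u^{re s}` for `u > 0`. [folklore] -/
theorem norm_ePow {u : ℝ} (hu : 0 < u) (s : ℂ) : ‖ePow s u‖ = u ^ s.re := by
  rw [ePow, Complex.norm_exp, Complex.re_ofReal_mul, Real.rpow_def_of_pos hu]

/-- `(ab)^s = a^s b^s` for `a, b > 0`. [folklore] -/
theorem ePow_mul {a b : ℝ} (ha : 0 < a) (hb : 0 < b) (s : ℂ) :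
    ePow s (a * b) = ePow s a * ePow s b := by
  rw [ePow, ePow, ePow, Real.log_mul ha.ne' hb.ne', ← Complex.exp_add]
  push_cast
  ring_nf

/-- `u^{s−1} = u^s / u` for `u > 0`. [folklore] -/
theorem ePow_sub_one {u : ℝ} (hu : 0 < u) (s : ℂ) : ePow (s - 1) u = ePow s u * (u : ℂ)⁻¹ := by
  rw [ePow, ePow, mul_sub, mul_one, Complex.exp_sub, div_eq_mul_inv]
  congr 2
  rw [← Complex.ofReal_exp, Real.exp_log hu]

/-- `u ↦ exp(s log u)` is smooth at every `u ≠ 0`. [folklore] -/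
theorem contDiffAt_ePow {u : ℝ} (hu : u ≠ 0) (s : ℂ) {n : WithTop ℕ∞} :
    ContDiffAt ℝ n (ePow s) u := by
  have h1 : ContDiffAt ℝ n (fun u : ℝ ↦ (Real.log u : ℂ)) u :=
    Complex.ofRealCLM.contDiff.contDiffAt.comp u (Real.contDiffAt_log.mpr hu)
  exact (h1.mul contDiffAt_const).cexp

/-- `(d/du) u^s = s u^{s−1}` for `u > 0`. [folklore] -/
theorem hasDerivAt_ePow {u : ℝ} (hu : 0 < u) (s : ℂ) :
    HasDerivAt (ePow s) (s * ePow (s - 1) u) u := by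
  have h1 : HasDerivAt (fun u : ℝ ↦ (Real.log u : ℂ) * s) ((u⁻¹ : ℝ) * s) u := by
    have := ((Real.hasDerivAt_log hu.ne').ofReal_comp).mul_const s
    simpa using this
  have h2 := h1.cexp
  have h3 : Complex.exp ((Real.log u : ℂ) * s) * ((u⁻¹ : ℝ) * s) = s * ePow (s - 1) u := by
    rw [ePow_sub_one hu, ePow]; push_cast; ring
  rw [← h3]
  exact h2

/-- `(d/du)^k u^s = s(s−1)⋯(s−k+1) u^{s−k}` on `u > 0`. [folklore] -/
theorem iteratedDeriv_ePow (k : ℕ) :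
    ∀ s : ℂ, Set.EqOn (iteratedDeriv k (ePow s))
      (fun u ↦ (∏ l ∈ Finset.range k, (s - l)) * ePow (s - k) u) (Set.Ioi 0) := by
  induction k with
  | zero => intro s u _; simp
  | succ k ih =>
    intro s u hu
    rw [iteratedDeriv_succ']
    have hEq : Set.EqOn (deriv (ePow s)) (fun u ↦ s * ePow (s - 1) u) (Set.Ioi 0) :=
      fun v hv ↦ (hasDerivAt_ePow hv s).deriv
    rw [(hEq.iteratedDeriv_of_isOpen isOpen_Ioi k) hu]
    simp only
    rw [iteratedDeriv_const_mul_field, ih (s - 1) hu, Finset.prod_range_succ']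
    push_cast
    ring_nf

/-- `|s(s−1)⋯(s−k+1)| ≤ k!(1+|s|)^k`. [folklore] -/
theorem norm_prod_sub_le (s : ℂ) (k : ℕ) :
    ‖∏ l ∈ Finset.range k, (s - l)‖ ≤ k.factorial * (1 + ‖s‖) ^ k := by
  induction k with
  | zero => simp
  | succ k ih =>
    rw [Finset.prod_range_succ, norm_mul, Nat.factorial_succ, pow_succ]
    have h1 : ‖s - k‖ ≤ (k + 1) * (1 + ‖s‖) := by
      calc ‖s - k‖ ≤ ‖s‖ + ‖(k : ℂ)‖ := norm_sub_le _ _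
        _ = ‖s‖ + k := by rw [Complex.norm_natCast]
        _ ≤ (k + 1) * (1 + ‖s‖) := by nlinarith [norm_nonneg s, k.cast_nonneg (α := ℝ)]
    push_cast
    calc ‖∏ l ∈ Finset.range k, (s - l)‖ * ‖s - k‖
        ≤ (k.factorial * (1 + ‖s‖) ^ k) * ((k + 1) * (1 + ‖s‖)) :=
          mul_le_mul ih h1 (norm_nonneg _) (by positivity)
      _ = (k + 1) * k.factorial * ((1 + ‖s‖) ^ k * (1 + ‖s‖)) := by ring

/-- On `u ≥ 1`: `|(d/du)^k u^{it}| ≤ k! (1+|t|)^k`. [folklore] -/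
theorem norm_iteratedDeriv_ePow_le {u : ℝ} (hu : 1 ≤ u) (t : ℝ) (k : ℕ) :
    ‖iteratedDeriv k (ePow (t * I)) u‖ ≤ k.factorial * (1 + |t|) ^ k := by
  have hu0 : 0 < u := by linarith
  rw [iteratedDeriv_ePow k (t * I) hu0, norm_mul, norm_ePow hu0]
  have h1 : ‖(t : ℂ) * I‖ = |t| := by simp
  have h2 : ((t : ℂ) * I - (k : ℂ)).re = -k := by simp
  rw [h2]
  have h3 : u ^ (-(k : ℝ)) ≤ 1 := Real.rpow_le_one_of_one_le_of_nonpos hu (by simp)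
  calc ‖∏ l ∈ Finset.range k, ((t : ℂ) * I - l)‖ * u ^ (-(k : ℝ))
      ≤ (k.factorial * (1 + ‖(t : ℂ) * I‖) ^ k) * 1 :=
        mul_le_mul (norm_prod_sub_le _ _) h3 (by positivity) (by positivity)
    _ = k.factorial * (1 + |t|) ^ k := by rw [h1, mul_one]

/-! ## §2. Smooth compactly supported functions times functions smooth near the support -/

/-- All derivatives vanish outside the topological support. [folklore] -/
theorem iteratedDeriv_eq_zero_of_notMem_tsupport {f : ℝ → ℂ} {x : ℝ} (hx : x ∉ tsupport f)
    (k : ℕ) : iteratedDeriv k f x = 0 := by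
  have h : f =ᶠ[𝓝 x] 0 := notMem_tsupport_iff_eventuallyEq.mp hx
  rw [Filter.EventuallyEq.iteratedDeriv_eq k h]
  exact iteratedDeriv_const_zero

/-- A `C^n` function whose topological support lies in a set `U`, times a function that is `C^n`
at every point of `U`, is `C^n`. [folklore] -/
theorem contDiff_mul_of_tsupport {Φ g : ℝ → ℂ} {U : Set ℝ} {n : WithTop ℕ∞}
    (hΦ : ContDiff ℝ n Φ) (hsupp : tsupport Φ ⊆ U) (hg : ∀ x ∈ U, ContDiffAt ℝ n g x) :
    ContDiff ℝ n (Φ * g) := by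
  rw [contDiff_iff_contDiffAt]
  intro x
  by_cases hx : x ∈ U
  · exact hΦ.contDiffAt.mul (hg x hx)
  · have hx' : x ∉ tsupport Φ := fun h ↦ hx (hsupp h)
    have h0 : Φ =ᶠ[𝓝 x] 0 := notMem_tsupport_iff_eventuallyEq.mp hx'
    have h1 : (Φ * g) =ᶠ[𝓝 x] (fun _ ↦ (0 : ℂ)) :=
      h0.mono fun y hy ↦ by simp [hy]
    exact (contDiffAt_const (c := (0 : ℂ))).congr_of_eventuallyEq h1

/-- `tsupport (Φ g) ⊆ tsupport Φ`. [folklore] -/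
theorem tsupport_mul_subset {Φ g : ℝ → ℂ} : tsupport (Φ * g) ⊆ tsupport Φ :=
  closure_mono fun x hx ↦ by
    simp only [Function.mem_support, Pi.mul_apply, ne_eq, mul_eq_zero, not_or] at hx ⊢
    exact hx.1

/-- Pointwise Leibniz bound: `|(Φg)^{(k)}(x)| ≤ ∑_i C(k,i) K_i G_{k−i}` from bounds on the
derivatives of the factors at `x`. [folklore] -/
theorem norm_iteratedDeriv_mul_le_of_bounds {Φ g : ℝ → ℂ} {x : ℝ} {k : ℕ}
    (hΦ : ContDiffAt ℝ k Φ x) (hg : ContDiffAt ℝ k g x) {K G : ℕ → ℝ}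
    (hK : ∀ i ≤ k, ‖iteratedDeriv i Φ x‖ ≤ K i) (hG : ∀ i ≤ k, ‖iteratedDeriv i g x‖ ≤ G i) :
    ‖iteratedDeriv k (Φ * g) x‖ ≤ ∑ i ∈ Finset.range (k + 1), (k.choose i) * K i * G (k - i) := by
  rw [iteratedDeriv_mul hΦ hg]
  refine (norm_sum_le _ _).trans (Finset.sum_le_sum fun i hi ↦ ?_)
  rw [Finset.mem_range] at hi
  rw [norm_mul, norm_mul, Complex.norm_natCast]
  have h1 := hK i (by omega)
  have h2 := hG (k - i) (by omega)
  have h3 : 0 ≤ K i := (norm_nonneg _).trans h1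
  gcongr

/-- A continuous function vanishing outside a compact set is bounded (with a nonnegative bound).
[folklore] -/
theorem exists_bound_of_continuous_of_subset {f : ℝ → ℂ} (hf : Continuous f) {S : Set ℝ}
    (hS : IsCompact S) (hfS : ∀ x ∉ S, f x = 0) : ∃ C, 0 ≤ C ∧ ∀ x, ‖f x‖ ≤ C := by
  obtain ⟨C, hC⟩ := hS.exists_bound_of_continuousOn hf.continuousOn
  refine ⟨max C 0, le_max_right _ _, fun x ↦ ?_⟩
  by_cases hx : x ∈ S
  · exact (hC x hx).trans (le_max_left _ _)
  · rw [hfS x hx, norm_zero]; exact le_max_right _ _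

/-- All derivatives of a smooth function with support in a compact set are bounded. [folklore] -/
theorem exists_bound_iteratedDeriv {Φ : ℝ → ℂ} (hΦ : ContDiff ℝ ∞ Φ) {S : Set ℝ} (hS : IsCompact S)
    (hsupp : tsupport Φ ⊆ S) (i : ℕ) : ∃ K, 0 ≤ K ∧ ∀ x, ‖iteratedDeriv i Φ x‖ ≤ K := by
  refine exists_bound_of_continuous_of_subset (hΦ.continuous_iteratedDeriv i (by
    exact_mod_cast le_top)) hS fun x hx ↦ ?_
  exact iteratedDeriv_eq_zero_of_notMem_tsupport (fun h ↦ hx (hsupp h)) i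

/-! ## §3. Guth–Maynard's `h_t(u) = w(u)² u^{it}` -/

/-- Guth–Maynard's `h_t(u) := w(u)² u^{it}` [cite: GuthMaynard2026, (4.3)], with `u^{it}`
realised as `exp(it log u)` (`= u^{it}` for `u > 0`, which contains the support of `w`). -/
def hFun (w : ℝ → ℝ) (t : ℝ) : ℝ → ℂ := fun u ↦ (((w u) ^ 2 : ℝ) : ℂ) * ePow (t * I) u

/-- The weight squared `w²` as a complex function. [cite: GuthMaynard2026, (4.3)] -/
def wSq (w : ℝ → ℝ) : ℝ → ℂ := fun u ↦ (((w u) ^ 2 : ℝ) : ℂ)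

/-- `h_t = w² · u^{it}` as a product of functions. [cite: GuthMaynard2026, (4.3)] -/
theorem hFun_eq_mul (w : ℝ → ℝ) (t : ℝ) : hFun w t = wSq w * ePow (t * I) := rfl

/-- `h_t(u) = w(u)² u^{it}` for `u > 0` (the paper's definition). [cite: GuthMaynard2026, (4.3)] -/
theorem hFun_apply_of_pos (w : ℝ → ℝ) (t : ℝ) {u : ℝ} (hu : 0 < u) :
    hFun w t u = (((w u) ^ 2 : ℝ) : ℂ) * (u : ℂ) ^ ((t : ℂ) * I) := by
  rw [hFun, ePow_eq_cpow hu]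

/-- `|h_t(u)| ≤ w(u)²`. [cite: GuthMaynard2026, (4.3)] -/
theorem norm_hFun_le (w : ℝ → ℝ) (t u : ℝ) : ‖hFun w t u‖ ≤ (w u) ^ 2 := by
  rw [hFun, norm_mul, ePow, Complex.norm_exp]
  have : (((Real.log u : ℂ)) * ((t : ℂ) * I)).re = 0 := by
    simp [Complex.mul_re]
  rw [this, Real.exp_zero, mul_one, Complex.norm_real, Real.norm_eq_abs, abs_of_nonneg (sq_nonneg _)]

section weight

variable {w : ℝ → ℝ}

/-- `w²` is smooth. [folklore] -/
theorem wSq_contDiff (hw : ContDiff ℝ ∞ w) : ContDiff ℝ ∞ (wSq w) := by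
  unfold wSq
  exact Complex.ofRealCLM.contDiff.comp (hw.pow 2)

/-- `w²` is supported in `[1, 2]`. [folklore] -/
theorem tsupport_wSq_subset (hsupp : Function.support w ⊆ Set.Icc 1 2) :
    tsupport (wSq w) ⊆ Set.Icc 1 2 := by
  refine closure_minimal (fun x hx ↦ hsupp ?_) isClosed_Icc
  simp only [wSq, Function.mem_support, ne_eq, Complex.ofReal_eq_zero, pow_eq_zero_iff,
    OfNat.ofNat_ne_zero, not_false_eq_true] at hx
  exact hx

/-- `h_t` vanishes off `[1, 2]`. [cite: GuthMaynard2026, (4.3)] -/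
theorem hFun_eq_zero_of_notMem (hsupp : Function.support w ⊆ Set.Icc 1 2) (t : ℝ) {u : ℝ}
    (hu : u ∉ Set.Icc 1 2) : hFun w t u = 0 := by
  have : w u = 0 := by
    by_contra h
    exact hu (hsupp h)
  simp [hFun, this]

/-- `h_t` is supported in `[1, 2]`. [cite: GuthMaynard2026, (4.3)] -/
theorem tsupport_hFun_subset (hsupp : Function.support w ⊆ Set.Icc 1 2) (t : ℝ) :
    tsupport (hFun w t) ⊆ Set.Icc 1 2 :=
  (tsupport_mul_subset (Φ := wSq w) (g := ePow (t * I))).trans (tsupport_wSq_subset hsupp)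

/-- `h_t` has compact support. [cite: GuthMaynard2026, (4.3)] -/
theorem hasCompactSupport_hFun (hsupp : Function.support w ⊆ Set.Icc 1 2) (t : ℝ) :
    HasCompactSupport (hFun w t) :=
  HasCompactSupport.of_support_subset_isCompact isCompact_Icc
    ((subset_tsupport _).trans (tsupport_hFun_subset hsupp t))

/-- `h_t` is smooth ("`w` is a smooth bump supported on `[1,2]`"). [cite: GuthMaynard2026, (4.3)] -/
theorem hFun_contDiff (hw : ContDiff ℝ ∞ w) (hsupp : Function.support w ⊆ Set.Icc 1 2) (t : ℝ) :
    ContDiff ℝ ∞ (hFun w t) := by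
  rw [hFun_eq_mul]
  refine contDiff_mul_of_tsupport (U := Set.Ioi 0) (wSq_contDiff hw)
    ((tsupport_wSq_subset hsupp).trans fun x hx ↦ ?_) fun x hx ↦ contDiffAt_ePow (ne_of_gt hx) _
  exact lt_of_lt_of_le one_pos hx.1

/-- `h_t` is continuous. [cite: GuthMaynard2026, (4.3)] -/
theorem hFun_continuous (hw : ContDiff ℝ ∞ w) (hsupp : Function.support w ⊆ Set.Icc 1 2)
    (t : ℝ) : Continuous (hFun w t) :=
  (hFun_contDiff hw hsupp t).continuous

/-- All derivatives of `h_t` vanish off `[1, 2]`. [cite: GuthMaynard2026, (4.3)] -/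
theorem iteratedDeriv_hFun_eq_zero (hsupp : Function.support w ⊆ Set.Icc 1 2) (t : ℝ) (k : ℕ)
    {u : ℝ} (hu : u ∉ Set.Icc 1 2) : iteratedDeriv k (hFun w t) u = 0 :=
  iteratedDeriv_eq_zero_of_notMem_tsupport (fun h ↦ hu (tsupport_hFun_subset hsupp t h)) k

/-- **`‖h_t^{(k)}‖_∞ ≪_k (1+|t|)^k`** ("Since `‖w^{(j)}‖_∞ ≪_j 1` … we have
`‖h_t^{(j)}‖_∞ ≪_j 1 + |t|^j`"). [cite: GuthMaynard2026, proof of Lemma 4.3] -/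
theorem norm_iteratedDeriv_hFun_le (hw : ContDiff ℝ ∞ w)
    (hsupp : Function.support w ⊆ Set.Icc 1 2) (k : ℕ) :
    ∃ C, 0 ≤ C ∧ ∀ t u : ℝ, ‖iteratedDeriv k (hFun w t) u‖ ≤ C * (1 + |t|) ^ k := by
  have hK := fun i ↦ exists_bound_iteratedDeriv (wSq_contDiff hw) isCompact_Icc
    (tsupport_wSq_subset hsupp) i
  choose K hK0 hK using hK
  have hC0 : 0 ≤ ∑ i ∈ Finset.range (k + 1), (k.choose i) * K i * (k - i).factorial :=
    Finset.sum_nonneg fun i _ ↦ by have := hK0 i; positivity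
  refine ⟨∑ i ∈ Finset.range (k + 1), (k.choose i) * K i * (k - i).factorial, hC0,
    fun t u ↦ ?_⟩
  by_cases hu : u ∈ Set.Icc 1 2
  · have hu0 : 0 < u := lt_of_lt_of_le one_pos hu.1
    rw [hFun_eq_mul]
    have h1 := norm_iteratedDeriv_mul_le_of_bounds (k := k)
      ((wSq_contDiff hw).contDiffAt.of_le (by exact_mod_cast le_top))
      (contDiffAt_ePow hu0.ne' (t * I)) (K := K)
      (G := fun i ↦ (i.factorial : ℝ) * (1 + |t|) ^ i) (fun i _ ↦ hK i u)
      (fun i _ ↦ norm_iteratedDeriv_ePow_le hu.1 t i)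
    refine h1.trans ?_
    rw [Finset.sum_mul]
    refine Finset.sum_le_sum fun i hi ↦ ?_
    have hik : k - i ≤ k := Nat.sub_le _ _
    have h1t : 1 ≤ 1 + |t| := by have := abs_nonneg t; linarith
    have hp : (1 + |t|) ^ (k - i) ≤ (1 + |t|) ^ k := pow_le_pow_right₀ h1t hik
    have := hK0 i
    calc (k.choose i : ℝ) * K i * ((k - i).factorial * (1 + |t|) ^ (k - i))
        = (k.choose i : ℝ) * K i * (k - i).factorial * (1 + |t|) ^ (k - i) := by ring
      _ ≤ (k.choose i : ℝ) * K i * (k - i).factorial * (1 + |t|) ^ k := by gcongr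
  · rw [iteratedDeriv_hFun_eq_zero hsupp t k hu, norm_zero]
    positivity

end weight


/-! ## §4. Fourier decay from derivative bounds (integration by parts) -/

/-- Derivatives of a compactly supported function are compactly supported. [folklore] -/
theorem hasCompactSupport_iteratedDeriv {f : ℝ → ℂ} (hf : HasCompactSupport f) (n : ℕ) :
    HasCompactSupport (iteratedDeriv n f) := by
  have h : iteratedDeriv n f = (fun L : (ℝ [×n]→L[ℝ] ℂ) ↦ L fun _ ↦ 1) ∘ iteratedFDeriv ℝ n f := by
    ext x; rfl
  rw [h]
  exact (hf.iteratedFDeriv (𝕜 := ℝ) n).comp_left (by simp)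

/-- `|f̂(ξ)| ≤ ‖f‖_{L¹}` (Mathlib's `VectorFourier.norm_fourierIntegral_le_integral_norm` for `𝓕`
on `ℝ`). [folklore] -/
theorem norm_fourier_le_integral_norm (f : ℝ → ℂ) (ξ : ℝ) : ‖𝓕 f ξ‖ ≤ ∫ u, ‖f u‖ :=
  VectorFourier.norm_fourierIntegral_le_integral_norm _ _ _ f ξ

/-- **Non-stationary phase, abstract form**: for a smooth compactly supported `f` and `ξ ≠ 0`,
`|f̂(ξ)| ≤ ‖f^{(k)}‖_{L¹} / (2π|ξ|)^k` (`k`-fold integration by parts, via Mathlib's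
`Real.fourier_iteratedDeriv`). [folklore] -/
theorem norm_fourier_le_of_iteratedDeriv {f : ℝ → ℂ} (hf : ContDiff ℝ ∞ f)
    (hfs : HasCompactSupport f) (k : ℕ) {ξ : ℝ} (hξ : ξ ≠ 0) :
    ‖𝓕 f ξ‖ ≤ (∫ u, ‖iteratedDeriv k f u‖) / (2 * π * |ξ|) ^ k := by
  have hint : ∀ n : ℕ, (n : ℕ∞) ≤ (⊤ : ℕ∞) → Integrable (iteratedDeriv n f) := fun n _ ↦
    (hf.continuous_iteratedDeriv n (by exact_mod_cast le_top)).integrable_of_hasCompactSupport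
      (hasCompactSupport_iteratedDeriv hfs n)
  have h := Real.fourier_iteratedDeriv (N := (⊤ : ℕ∞)) (n := k) hf hint le_top
  have h1 : 𝓕 (iteratedDeriv k f) ξ = (2 * π * I * ξ) ^ k • 𝓕 f ξ := congrFun h ξ
  have h2 : ‖𝓕 (iteratedDeriv k f) ξ‖ ≤ ∫ u, ‖iteratedDeriv k f u‖ :=
    norm_fourier_le_integral_norm _ _
  rw [h1, norm_smul, norm_pow] at h2
  have h3 : ‖2 * (π : ℂ) * I * ξ‖ = 2 * π * |ξ| := by
    simp [abs_of_pos Real.pi_pos]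
  rw [h3] at h2
  have hpos : 0 < (2 * π * |ξ|) ^ k := by
    have := abs_pos.mpr hξ
    positivity
  rw [le_div_iff₀ hpos, mul_comm]
  exact h2

/-- `∫ ‖g‖ ≤ C (b − a)` if `‖g‖ ≤ C` everywhere and `g = 0` off `[a, b]`. [folklore] -/
theorem integral_norm_le_of_bound_Icc {g : ℝ → ℂ} {a b C : ℝ} (hab : a ≤ b)
    (hg : ∀ u, ‖g u‖ ≤ C) (hg0 : ∀ u ∉ Set.Icc a b, g u = 0) :
    ∫ u, ‖g u‖ ≤ C * (b - a) := by
  have h1 : ∫ u, ‖g u‖ = ∫ u in Set.Icc a b, ‖g u‖ := by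
    rw [MeasureTheory.setIntegral_eq_integral_of_forall_compl_eq_zero]
    intro u hu
    rw [hg0 u hu, norm_zero]
  rw [h1]
  have h2 : ‖∫ u in Set.Icc a b, ‖g u‖‖ ≤ C * (volume (Set.Icc a b)).toReal :=
    MeasureTheory.norm_setIntegral_le_of_norm_le_const (by rw [Real.volume_Icc]; simp)
      fun u _ ↦ by rw [Real.norm_eq_abs, abs_norm]; exact hg u
  rw [Real.volume_Icc, ENNReal.toReal_ofReal (by linarith)] at h2
  exact (Real.le_norm_self _).trans h2

section weight

variable {w : ℝ → ℝ}

/-- **Guth–Maynard Lemma 4.3, first bound** ("Non-stationary phase"): for every `j ≥ 0`,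
`|ĥ_t(ξ)| ≪_j (1+|t|)^j / |ξ|^j` (`ξ ≠ 0`), uniformly in `t`.
[cite: GuthMaynard2026, Lemma 4.3 (first part)] -/
theorem norm_fourier_hFun_le_pow_div (hw : ContDiff ℝ ∞ w)
    (hsupp : Function.support w ⊆ Set.Icc 1 2) (j : ℕ) :
    ∃ C, 0 ≤ C ∧ ∀ t ξ : ℝ, ξ ≠ 0 → ‖𝓕 (hFun w t) ξ‖ ≤ C * (1 + |t|) ^ j / |ξ| ^ j := by
  obtain ⟨C, hC0, hC⟩ := norm_iteratedDeriv_hFun_le hw hsupp j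
  refine ⟨C, hC0, fun t ξ hξ ↦ ?_⟩
  have h1 := norm_fourier_le_of_iteratedDeriv (hFun_contDiff hw hsupp t)
    (hasCompactSupport_hFun hsupp t) j hξ
  have h2 : ∫ u, ‖iteratedDeriv j (hFun w t) u‖ ≤ C * (1 + |t|) ^ j * (2 - 1) :=
    integral_norm_le_of_bound_Icc (by norm_num) (hC t)
      (fun u hu ↦ iteratedDeriv_hFun_eq_zero hsupp t j hu)
  rw [show (2 : ℝ) - 1 = 1 by norm_num, mul_one] at h2
  have hξ0 : 0 < |ξ| := abs_pos.mpr hξ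
  have h3 : |ξ| ^ j ≤ (2 * π * |ξ|) ^ j :=
    pow_le_pow_left₀ (abs_nonneg _) (by nlinarith [Real.two_le_pi]) j
  calc ‖𝓕 (hFun w t) ξ‖ ≤ (∫ u, ‖iteratedDeriv j (hFun w t) u‖) / (2 * π * |ξ|) ^ j := h1
    _ ≤ (C * (1 + |t|) ^ j) / |ξ| ^ j :=
        div_le_div₀ (by positivity) h2 (pow_pos hξ0 j) h3

/-- The trivial bound `|ĥ_t(ξ)| ≤ ‖h_t‖_{L¹} ≪ 1` (Lemma 4.3 with `j = 0`, all `ξ`).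
[cite: GuthMaynard2026, Lemma 4.3] -/
theorem norm_fourier_hFun_le (hw : ContDiff ℝ ∞ w) (hsupp : Function.support w ⊆ Set.Icc 1 2) :
    ∃ C, 0 ≤ C ∧ ∀ t ξ : ℝ, ‖𝓕 (hFun w t) ξ‖ ≤ C := by
  obtain ⟨C, hC0, hC⟩ := norm_iteratedDeriv_hFun_le hw hsupp 0
  refine ⟨C, hC0, fun t ξ ↦ ?_⟩
  have h2 : ∫ u, ‖iteratedDeriv 0 (hFun w t) u‖ ≤ C * (1 + |t|) ^ 0 * (2 - 1) :=
    integral_norm_le_of_bound_Icc (by norm_num) (hC t)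
      (fun u hu ↦ iteratedDeriv_hFun_eq_zero hsupp t 0 hu)
  simp only [iteratedDeriv_zero, pow_zero, mul_one] at h2
  rw [show (2 : ℝ) - 1 = 1 by norm_num, mul_one] at h2
  exact (norm_fourier_le_integral_norm _ _).trans h2

end weight

/-! ## §5. The second bound: the substitution `u = e^v` -/

/-- `Ψ_w(v) = e^v w(e^v)²`: the weight after the substitution `u = e^v` in `ĥ_t(ξ)`.
[cite: GuthMaynard2026, proof of Lemma 4.3] -/
def expWeight (w : ℝ → ℝ) : ℝ → ℂ := fun v ↦ ((Real.exp v * (w (Real.exp v)) ^ 2 : ℝ) : ℂ)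

/-- The coefficient `−2πiξ` of the phase `e(−ξu) = exp(−2πiξu)`. [folklore] -/
def phaseCoeff (ξ : ℝ) : ℂ := ((-(2 * π * ξ) : ℝ) : ℂ) * I

/-- `F_ξ(v) = e(−ξ e^v) = exp(−2πiξ e^v)`: the phase after the substitution `u = e^v`.
[cite: GuthMaynard2026, proof of Lemma 4.3] -/
def expPhase (ξ : ℝ) : ℝ → ℂ := fun v ↦ Complex.exp (phaseCoeff ξ * (Real.exp v : ℂ))

/-- `|−2πiξ| = 2π|ξ|`. [folklore] -/
theorem norm_phaseCoeff (ξ : ℝ) : ‖phaseCoeff ξ‖ = 2 * π * |ξ| := by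
  rw [phaseCoeff, norm_mul, Complex.norm_I, mul_one, Complex.norm_real, Real.norm_eq_abs,
    abs_neg, abs_mul, abs_mul, abs_of_pos two_pos, abs_of_pos Real.pi_pos]

/-- `|e(−ξe^v)| = 1`. [folklore] -/
theorem norm_expPhase (ξ v : ℝ) : ‖expPhase ξ v‖ = 1 := by
  rw [expPhase, Complex.norm_exp]
  have : (phaseCoeff ξ * (Real.exp v : ℂ)).re = 0 := by
    simp [phaseCoeff, Complex.mul_re]
  rw [this, Real.exp_zero]

/-- `(d/dv) e(−ξe^v) = e(−ξe^v) · (−2πiξ e^v)`. [folklore] -/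
theorem hasDerivAt_expPhase (ξ v : ℝ) :
    HasDerivAt (expPhase ξ) (expPhase ξ v * (phaseCoeff ξ * (Real.exp v : ℂ))) v := by
  have h1 : HasDerivAt (fun v : ℝ ↦ phaseCoeff ξ * (Real.exp v : ℂ))
      (phaseCoeff ξ * (Real.exp v : ℂ)) v :=
    ((Real.hasDerivAt_exp v).ofReal_comp).const_mul _
  exact h1.cexp

/-- `(d/dv) e(−ξe^v) = e(−ξe^v) · (−2πiξ e^v)`, as functions. [folklore] -/
theorem deriv_expPhase (ξ : ℝ) :
    deriv (expPhase ξ) = expPhase ξ * fun v ↦ phaseCoeff ξ * (Real.exp v : ℂ) :=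
  funext fun v ↦ (hasDerivAt_expPhase ξ v).deriv

/-- `v ↦ e(−ξe^v)` is smooth. [folklore] -/
theorem contDiff_expPhase (ξ : ℝ) {n : WithTop ℕ∞} : ContDiff ℝ n (expPhase ξ) := by
  unfold expPhase
  exact (contDiff_const.mul (Complex.ofRealCLM.contDiff.comp Real.contDiff_exp)).cexp

/-- `v ↦ e^v` (complex-valued) is smooth. [folklore] -/
theorem contDiff_ofReal_exp {n : WithTop ℕ∞} : ContDiff ℝ n (fun v : ℝ ↦ (Real.exp v : ℂ)) :=
  Complex.ofRealCLM.contDiff.comp Real.contDiff_exp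

/-- `(d/dv)^i e^v = e^v`. [folklore] -/
theorem iteratedDeriv_ofReal_exp (i : ℕ) :
    iteratedDeriv i (fun v : ℝ ↦ (Real.exp v : ℂ)) = fun v : ℝ ↦ (Real.exp v : ℂ) := by
  induction i with
  | zero => simp
  | succ i ih =>
    rw [iteratedDeriv_succ']
    have : deriv (fun v : ℝ ↦ (Real.exp v : ℂ)) = fun v : ℝ ↦ (Real.exp v : ℂ) :=
      funext fun v ↦ ((Real.hasDerivAt_exp v).ofReal_comp).deriv
    rw [this, ih]

/-- `|(d/dv)^i (−2πiξ e^v)| ≤ 2·2π|ξ|` for `v ≤ log 2`. [folklore] -/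
theorem norm_iteratedDeriv_phase_mul_exp_le (ξ : ℝ) (i : ℕ) {v : ℝ} (hv : v ≤ Real.log 2) :
    ‖iteratedDeriv i (fun v ↦ phaseCoeff ξ * (Real.exp v : ℂ)) v‖ ≤ 2 * ‖phaseCoeff ξ‖ := by
  rw [iteratedDeriv_const_mul_field, iteratedDeriv_ofReal_exp, norm_mul, Complex.norm_real,
    Real.norm_eq_abs, abs_of_pos (Real.exp_pos v), mul_comm]
  have : Real.exp v ≤ 2 := by
    calc Real.exp v ≤ Real.exp (Real.log 2) := Real.exp_le_exp.mpr hv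
      _ = 2 := Real.exp_log two_pos
  gcongr

/-- All `v`-derivatives of `e(−ξe^v)` on `v ≤ log 2` are `≪_k (1+|ξ|)^k` (induction on `k` with the
Leibniz rule, `F' = F · (−2πiξe^v)`). [folklore] -/
theorem norm_iteratedDeriv_expPhase_le (k : ℕ) :
    ∃ D, 0 ≤ D ∧ ∀ i ≤ k, ∀ ξ v : ℝ, v ≤ Real.log 2 →
      ‖iteratedDeriv i (expPhase ξ) v‖ ≤ D * (1 + ‖phaseCoeff ξ‖) ^ i := by
  induction k with
  | zero =>
    refine ⟨1, zero_le_one, fun i hi ξ v _ ↦ ?_⟩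
    obtain rfl : i = 0 := Nat.le_zero.mp hi
    simp [norm_expPhase]
  | succ k ih =>
    obtain ⟨D, hD0, hD⟩ := ih
    refine ⟨2 ^ (k + 1) * D, by positivity, fun i hi ξ v hv ↦ ?_⟩
    set A : ℝ := ‖phaseCoeff ξ‖ with hA
    have hA0 : 0 ≤ A := norm_nonneg _
    rcases Nat.lt_or_eq_of_le hi with hlt | rfl
    · refine (hD i (by omega) ξ v hv).trans ?_
      have h1 : D ≤ 2 ^ (k + 1) * D := by
        have : (1 : ℝ) ≤ 2 ^ (k + 1) := one_le_pow₀ (by norm_num)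
        nlinarith
      gcongr
    · rw [iteratedDeriv_succ', deriv_expPhase]
      have hL := norm_iteratedDeriv_mul_le_of_bounds (k := k)
        ((contDiff_expPhase ξ).contDiffAt)
        ((contDiff_const.mul contDiff_ofReal_exp).contDiffAt)
        (K := fun j ↦ D * (1 + A) ^ j) (G := fun _ ↦ 2 * A)
        (fun j hj ↦ hD j hj ξ v hv) (fun j _ ↦ norm_iteratedDeriv_phase_mul_exp_le ξ j hv)
      refine hL.trans ?_
      have h1A : 1 ≤ 1 + A := by linarith
      calc ∑ j ∈ Finset.range (k + 1), (k.choose j : ℝ) * (D * (1 + A) ^ j) * (2 * A)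
          ≤ ∑ j ∈ Finset.range (k + 1), (k.choose j : ℝ) * (D * (1 + A) ^ k) * (2 * (1 + A)) := by
            refine Finset.sum_le_sum fun j hj ↦ ?_
            rw [Finset.mem_range] at hj
            have : (1 + A) ^ j ≤ (1 + A) ^ k := pow_le_pow_right₀ h1A (by omega)
            gcongr
            linarith
        _ = (∑ j ∈ Finset.range (k + 1), (k.choose j : ℝ)) * (2 * D * (1 + A) ^ (k + 1)) := by
            rw [Finset.sum_mul]
            refine Finset.sum_congr rfl fun j _ ↦ ?_
            ring
        _ = 2 ^ (k + 1) * D * (1 + A) ^ (k + 1) := by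
            have : (∑ j ∈ Finset.range (k + 1), (k.choose j : ℝ)) = 2 ^ k := by
              rw [← Nat.cast_sum, Nat.sum_range_choose]; push_cast; ring
            rw [this]; ring

section weight

variable {w : ℝ → ℝ}

/-- `Ψ_w(v) = e^v w(e^v)²` is smooth. [folklore] -/
theorem expWeight_contDiff (hw : ContDiff ℝ ∞ w) : ContDiff ℝ ∞ (expWeight w) := by
  unfold expWeight
  exact Complex.ofRealCLM.contDiff.comp (Real.contDiff_exp.mul ((hw.comp Real.contDiff_exp).pow 2))

/-- `Ψ_w` is supported in `[0, log 2]` (as `w` is supported in `[1, 2]`). [folklore] -/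
theorem tsupport_expWeight_subset (hsupp : Function.support w ⊆ Set.Icc 1 2) :
    tsupport (expWeight w) ⊆ Set.Icc 0 (Real.log 2) := by
  refine closure_minimal (fun v hv ↦ ?_) isClosed_Icc
  simp only [expWeight, Function.mem_support, ne_eq, Complex.ofReal_eq_zero, mul_eq_zero,
    Real.exp_ne_zero, false_or, pow_eq_zero_iff, OfNat.ofNat_ne_zero, not_false_eq_true] at hv
  have h := hsupp hv
  constructor
  · by_contra h0
    push Not at h0
    have : Real.exp v < 1 := Real.exp_lt_one_iff.mpr h0
    linarith [h.1]
  · by_contra h0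
    push Not at h0
    have : 2 < Real.exp v := by
      calc (2 : ℝ) = Real.exp (Real.log 2) := (Real.exp_log two_pos).symm
        _ < Real.exp v := Real.exp_lt_exp.mpr h0
    linarith [h.2]

/-- All `v`-derivatives of `Ψ_w(v) e(−ξ e^v)` are `≪_k (1+|ξ|)^k` ("`‖g_ξ^{(j)}‖_∞ ≪_j 1 + |ξ|^j`"
in the paper's variables). [cite: GuthMaynard2026, proof of Lemma 4.3] -/
theorem norm_iteratedDeriv_expWeight_mul_le (hw : ContDiff ℝ ∞ w)
    (hsupp : Function.support w ⊆ Set.Icc 1 2) (k : ℕ) :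
    ∃ C, 0 ≤ C ∧ ∀ ξ v : ℝ,
      ‖iteratedDeriv k (expWeight w * expPhase ξ) v‖ ≤ C * (1 + |ξ|) ^ k := by
  have hK := fun i ↦ exists_bound_iteratedDeriv (expWeight_contDiff hw) isCompact_Icc
    (tsupport_expWeight_subset hsupp) i
  choose K hK0 hK using hK
  obtain ⟨D, hD0, hD⟩ := norm_iteratedDeriv_expPhase_le k
  have hC0 : 0 ≤ ∑ i ∈ Finset.range (k + 1), (k.choose i) * K i * D :=
    Finset.sum_nonneg fun i _ ↦ by have := hK0 i; positivity
  refine ⟨(∑ i ∈ Finset.range (k + 1), (k.choose i) * K i * D) * 9 ^ k, by positivity,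
    fun ξ v ↦ ?_⟩
  by_cases hv : v ∈ tsupport (expWeight w)
  · have hv2 : v ≤ Real.log 2 := (tsupport_expWeight_subset hsupp hv).2
    set A : ℝ := ‖phaseCoeff ξ‖ with hA
    have hA0 : 0 ≤ A := norm_nonneg _
    have h1 := norm_iteratedDeriv_mul_le_of_bounds (k := k)
      ((expWeight_contDiff hw).contDiffAt.of_le (by exact_mod_cast le_top))
      ((contDiff_expPhase ξ).contDiffAt) (K := K)
      (G := fun i ↦ D * (1 + A) ^ i) (fun i _ ↦ hK i v)
      (fun i hi ↦ hD i hi ξ v hv2)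
    refine h1.trans ?_
    have h1A : 1 ≤ 1 + A := by linarith
    have hA7 : 1 + A ≤ 9 * (1 + |ξ|) := by
      rw [hA, norm_phaseCoeff]
      nlinarith [mul_le_mul_of_nonneg_right Real.pi_le_four (abs_nonneg ξ), abs_nonneg ξ]
    calc ∑ i ∈ Finset.range (k + 1), (k.choose i : ℝ) * K i * (D * (1 + A) ^ (k - i))
        ≤ ∑ i ∈ Finset.range (k + 1), (k.choose i : ℝ) * K i * (D * (1 + A) ^ k) := by
          refine Finset.sum_le_sum fun i _ ↦ ?_
          have := hK0 i
          have : (1 + A) ^ (k - i) ≤ (1 + A) ^ k := pow_le_pow_right₀ h1A (Nat.sub_le _ _)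
          gcongr
      _ = (∑ i ∈ Finset.range (k + 1), (k.choose i : ℝ) * K i * D) * (1 + A) ^ k := by
          rw [Finset.sum_mul]
          refine Finset.sum_congr rfl fun i _ ↦ ?_
          ring
      _ ≤ (∑ i ∈ Finset.range (k + 1), (k.choose i : ℝ) * K i * D) * (9 * (1 + |ξ|)) ^ k := by
          gcongr
      _ = (∑ i ∈ Finset.range (k + 1), (k.choose i : ℝ) * K i * D) * 9 ^ k * (1 + |ξ|) ^ k := by
          rw [mul_pow]; ring
  · rw [iteratedDeriv_eq_zero_of_notMem_tsupport (fun h ↦ hv (tsupport_mul_subset h)) k,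
      norm_zero]
    positivity

/-- **The substitution `u = e^v`**: `ĥ_t(ξ) = ∫ Ψ_w(v) e(−ξe^v) e^{itv} dv`, i.e. the Fourier
transform of `Ψ_w · F_ξ` at `−t/(2π)`. [cite: GuthMaynard2026, proof of Lemma 4.3] -/
theorem fourier_hFun_eq_fourier_expWeight (hsupp : Function.support w ⊆ Set.Icc 1 2) (t ξ : ℝ) :
    𝓕 (hFun w t) ξ = 𝓕 (expWeight w * expPhase ξ) (-t / (2 * π)) := by
  rw [Real.fourier_real_eq, Real.fourier_real_eq]
  have h1 : ∫ u, 𝐞 (-(u * ξ)) • hFun w t u = ∫ u in Set.Ioi 0, 𝐞 (-(u * ξ)) • hFun w t u := by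
    rw [setIntegral_eq_integral_of_forall_compl_eq_zero]
    intro u hu
    have : u ∉ Set.Icc 1 2 := fun h ↦ hu (lt_of_lt_of_le one_pos h.1)
    rw [hFun_eq_zero_of_notMem hsupp t this, smul_zero]
  have h2 : Set.Ioi (0 : ℝ) = Real.exp '' Set.univ := by rw [Set.image_univ, Real.range_exp]
  rw [h1, h2, integral_image_eq_integral_abs_deriv_smul MeasurableSet.univ
    (fun x _ ↦ (Real.hasDerivAt_exp x).hasDerivWithinAt) Real.exp_injective.injOn,
    Measure.restrict_univ]
  refine integral_congr_ae (Filter.Eventually.of_forall fun v ↦ ?_)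
  simp only [Circle.smul_def, Real.fourierChar_apply, hFun, ePow, expWeight, expPhase, phaseCoeff,
    Pi.mul_apply, Real.log_exp, abs_of_pos (Real.exp_pos v), Complex.real_smul]
  have e1 : (2 * π * -(v * (-t / (2 * π))) : ℝ) = v * t := by
    field_simp
  rw [e1]
  have e2 : Complex.exp (((2 * π * -(Real.exp v * ξ) : ℝ) : ℂ) * I) =
      Complex.exp (((-(2 * π * ξ) : ℝ) : ℂ) * I * (Real.exp v : ℂ)) := by
    congr 1; push_cast; ring
  have e3 : Complex.exp (((v : ℝ) : ℂ) * ((t : ℂ) * I)) = Complex.exp (((v * t : ℝ) : ℂ) * I) := by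
    congr 1; push_cast; ring
  rw [e2, e3]
  push_cast
  ring

/-- **Guth–Maynard Lemma 4.3, second bound** ("Non-stationary phase"): for every `j ≥ 0`,
`|ĥ_t(ξ)| ≪_j (1+|ξ|)^j / |t|^j` (`t ≠ 0`). (The paper integrates by parts against `u^{it}`;
we substitute `u = e^v`, after which this is `j`-fold integration by parts in a Fourier
integral in `v`.) [cite: GuthMaynard2026, Lemma 4.3 (second part)] -/
theorem norm_fourier_hFun_le_pow_div' (hw : ContDiff ℝ ∞ w)
    (hsupp : Function.support w ⊆ Set.Icc 1 2) (j : ℕ) :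
    ∃ C, 0 ≤ C ∧ ∀ t ξ : ℝ, t ≠ 0 → ‖𝓕 (hFun w t) ξ‖ ≤ C * (1 + |ξ|) ^ j / |t| ^ j := by
  obtain ⟨C, hC0, hC⟩ := norm_iteratedDeriv_expWeight_mul_le hw hsupp j
  refine ⟨C, hC0, fun t ξ ht ↦ ?_⟩
  rw [fourier_hFun_eq_fourier_expWeight hsupp]
  have hsm : ContDiff ℝ ∞ (expWeight w * expPhase ξ) :=
    (expWeight_contDiff hw).mul (contDiff_expPhase ξ)
  have hcs : HasCompactSupport (expWeight w * expPhase ξ) :=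
    HasCompactSupport.of_support_subset_isCompact isCompact_Icc
      ((subset_tsupport _).trans (tsupport_mul_subset.trans (tsupport_expWeight_subset hsupp)))
  have hη : -t / (2 * π) ≠ 0 := by
    have := Real.pi_pos
    field_simp
    simpa using ht
  have h1 := norm_fourier_le_of_iteratedDeriv hsm hcs j hη
  have h2 : 2 * π * |(-t / (2 * π))| = |t| := by
    rw [abs_div, abs_neg, abs_of_pos (by positivity : (0 : ℝ) < 2 * π)]
    field_simp
  rw [h2] at h1
  have h3 : ∫ u, ‖iteratedDeriv j (expWeight w * expPhase ξ) u‖ ≤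
      C * (1 + |ξ|) ^ j * (Real.log 2 - 0) :=
    integral_norm_le_of_bound_Icc (Real.log_nonneg one_le_two) (hC ξ) fun u hu ↦
      iteratedDeriv_eq_zero_of_notMem_tsupport
        (fun h ↦ hu ((tsupport_mul_subset.trans (tsupport_expWeight_subset hsupp)) h)) j
  have h4 : Real.log 2 - 0 ≤ 1 := by
    rw [sub_zero]
    have := Real.log_le_sub_one_of_pos two_pos; linarith
  have ht0 : 0 < |t| ^ j := pow_pos (abs_pos.mpr ht) j
  calc ‖𝓕 (expWeight w * expPhase ξ) (-t / (2 * π))‖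
      ≤ (∫ u, ‖iteratedDeriv j (expWeight w * expPhase ξ) u‖) / |t| ^ j := h1
    _ ≤ C * (1 + |ξ|) ^ j * (Real.log 2 - 0) / |t| ^ j := by gcongr
    _ ≤ C * (1 + |ξ|) ^ j * 1 / |t| ^ j := by gcongr
    _ = C * (1 + |ξ|) ^ j / |t| ^ j := by rw [mul_one]

end weight


/-! ## §6. Poisson summation for the entries of the Gram matrix -/

/-- Dilation: `𝓕[u ↦ g(u/c)](ξ) = c · ĝ(cξ)` for `c > 0`. [folklore] -/
theorem fourier_comp_div (g : ℝ → ℂ) {c : ℝ} (hc : 0 < c) (ξ : ℝ) :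
    𝓕 (fun u ↦ g (u / c)) ξ = c * 𝓕 g (c * ξ) := by
  rw [Real.fourier_real_eq, Real.fourier_real_eq]
  have h : (fun u : ℝ ↦ 𝐞 (-(u * ξ)) • g (u / c)) =
      fun u ↦ (fun y ↦ 𝐞 (-(y * (c * ξ))) • g y) (u / c) := by
    ext u
    have : u / c * (c * ξ) = u * ξ := by field_simp
    simp only [this]
  rw [h, Measure.integral_comp_div (fun y ↦ 𝐞 (-(y * (c * ξ))) • g y) c, abs_of_pos hc,
    Complex.real_smul]

/-- A compactly supported function is `O(|x|^{-b})` at infinity (it is eventually `0`). [folklore] -/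
theorem isBigO_cocompact_of_hasCompactSupport {f : ℝ → ℂ} (hf : HasCompactSupport f) (b : ℝ) :
    f =O[cocompact ℝ] (fun x : ℝ ↦ |x| ^ (-b)) := by
  have h : ∀ᶠ x in cocompact ℝ, f x = 0 := by
    rw [Filter.eventually_iff_exists_mem]
    exact ⟨(tsupport f)ᶜ, hf.compl_mem_cocompact, fun x hx ↦ image_eq_zero_of_notMem_tsupport hx⟩
  exact Asymptotics.IsBigO.of_bound 0 (h.mono fun x hx ↦ by simp [hx])

/-- A bound `‖F(ξ)‖ ≤ C|ξ|^{-2}` for `|ξ| ≥ 1` gives `F = O(|ξ|^{-2})` at infinity. [folklore] -/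
theorem isBigO_cocompact_of_bound {F : ℝ → ℂ} {C : ℝ}
    (h : ∀ ξ : ℝ, 1 ≤ |ξ| → ‖F ξ‖ ≤ C * |ξ| ^ (-2 : ℝ)) :
    F =O[cocompact ℝ] (fun x : ℝ ↦ |x| ^ (-2 : ℝ)) := by
  apply Asymptotics.IsBigO.of_bound C
  rw [Filter.eventually_iff_exists_mem]
  refine ⟨(Metric.closedBall 0 1)ᶜ, (isCompact_closedBall (0 : ℝ) 1).compl_mem_cocompact,
    fun ξ hξ ↦ ?_⟩
  simp only [Set.mem_compl_iff, Metric.mem_closedBall, dist_zero_right, Real.norm_eq_abs,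
    not_le] at hξ
  rw [Real.norm_of_nonneg (Real.rpow_nonneg (abs_nonneg _) _)]
  exact h ξ hξ.le

section weight

variable {w : ℝ → ℝ}

/-- **Poisson summation for `h_t`** ("`∑_n h_t(n/N) = N ∑_m ĥ_t(Nm)`"), the first step in the
proofs of Lemmas 4.4 and 4.5. [cite: GuthMaynard2026, proofs of Lemmas 4.4 and 4.5] -/
theorem tsum_hFun_eq_tsum_fourier (hw : ContDiff ℝ ∞ w) (hsupp : Function.support w ⊆ Set.Icc 1 2)
    (t : ℝ) {N : ℝ} (hN : 0 < N) :
    ∑' n : ℤ, hFun w t (n / N) = ∑' m : ℤ, (N : ℂ) * 𝓕 (hFun w t) (N * m) := by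
  set f : ℝ → ℂ := fun u ↦ hFun w t (u / N) with hf
  have hfc : Continuous f := (hFun_continuous hw hsupp t).comp (continuous_id.div_const N)
  have hfsupp : Function.support f ⊆ Set.Icc N (2 * N) := by
    intro u hu
    rw [Function.mem_support] at hu
    by_contra hu'
    apply hu
    apply hFun_eq_zero_of_notMem hsupp t
    intro h
    apply hu'
    constructor
    · have := h.1; rwa [le_div_iff₀ hN, one_mul] at this
    · have := h.2; rwa [div_le_iff₀ hN] at this
  have hfcs : HasCompactSupport f :=
    HasCompactSupport.of_support_subset_isCompact isCompact_Icc hfsupp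
  have hfO : f =O[cocompact ℝ] (fun x : ℝ ↦ |x| ^ (-(2 : ℝ))) :=
    isBigO_cocompact_of_hasCompactSupport hfcs 2
  obtain ⟨C, hC0, hC⟩ := norm_fourier_hFun_le_pow_div hw hsupp 2
  have hFf_eq : ∀ ξ : ℝ, 𝓕 f ξ = N * 𝓕 (hFun w t) (N * ξ) := fun ξ ↦
    fourier_comp_div (hFun w t) hN ξ
  have hFf : 𝓕 f =O[cocompact ℝ] (fun x : ℝ ↦ |x| ^ (-(2 : ℝ))) := by
    refine isBigO_cocompact_of_bound (C := C * (1 + |t|) ^ 2 / N) fun ξ hξ ↦ ?_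
    have hξ0 : ξ ≠ 0 := by intro h; rw [h, abs_zero] at hξ; linarith
    have hNξ : N * ξ ≠ 0 := mul_ne_zero hN.ne' hξ0
    rw [hFf_eq, norm_mul, Complex.norm_real, Real.norm_of_nonneg hN.le]
    have h1 := hC t (N * ξ) hNξ
    rw [abs_mul, abs_of_pos hN, mul_pow] at h1
    have hξpos : 0 < |ξ| := abs_pos.mpr hξ0
    calc N * ‖𝓕 (hFun w t) (N * ξ)‖ ≤ N * (C * (1 + |t|) ^ 2 / (N ^ 2 * |ξ| ^ 2)) := by gcongr
      _ = C * (1 + |t|) ^ 2 / N * |ξ| ^ (-2 : ℝ) := by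
          rw [Real.rpow_neg (abs_nonneg _), show (2 : ℝ) = (2 : ℕ) by norm_num, Real.rpow_natCast]
          field_simp
  have hP := Real.tsum_eq_tsum_fourier_of_rpow_decay hfc one_lt_two hfO hFf 0
  simp only [zero_add, QuotientAddGroup.mk_zero, fourier_eval_zero, mul_one] at hP
  rw [hP]
  exact tsum_congr fun m ↦ hFf_eq m

/-- For `n, N ≥ 1`: `w(n/N)² n^{it} = N^{it} h_t(n/N)`. [cite: GuthMaynard2026, proof of Lemma 4.5] -/
theorem weight_mul_cpow_eq (t : ℝ) {N n : ℕ} (hN : 1 ≤ N) (hn : 1 ≤ n) :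
    (((w ((n : ℝ) / N)) ^ 2 : ℝ) : ℂ) * (n : ℂ) ^ ((t : ℂ) * I) =
      (N : ℂ) ^ ((t : ℂ) * I) * hFun w t ((n : ℝ) / N) := by
  have hN0 : (0 : ℝ) < N := by exact_mod_cast hN
  have hn0 : (0 : ℝ) < n := by exact_mod_cast hn
  have h1 : (N : ℂ) ^ ((t : ℂ) * I) = ePow (t * I) (N : ℝ) := by
    rw [ePow_eq_cpow hN0]; norm_cast
  have h2 : (n : ℂ) ^ ((t : ℂ) * I) = ePow (t * I) (n : ℝ) := by
    rw [ePow_eq_cpow hn0]; norm_cast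
  rw [h1, h2, hFun, show (n : ℝ) = N * ((n : ℝ) / N) by field_simp, ePow_mul hN0 (by positivity),
    show (N : ℝ) * ((n : ℝ) / N) = n by field_simp]
  ring

/-- **The Gram-matrix entry by Poisson summation**:
`∑_{N ≤ n ≤ 2N} w(n/N)² n^{it} = N^{1+it} ∑_{m ∈ ℤ} ĥ_t(Nm)` (`N ≥ 1`).
[cite: GuthMaynard2026, proofs of Lemmas 4.4 and 4.5] -/
theorem sum_weight_sq_cpow_eq (hw : ContDiff ℝ ∞ w) (hsupp : Function.support w ⊆ Set.Icc 1 2)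
    {N : ℕ} (hN : 1 ≤ N) (t : ℝ) :
    ∑ n ∈ Finset.Icc N (2 * N), (((w ((n : ℝ) / N)) ^ 2 : ℝ) : ℂ) * (n : ℂ) ^ ((t : ℂ) * I) =
      (N : ℂ) ^ ((t : ℂ) * I) * N * ∑' m : ℤ, 𝓕 (hFun w t) (N * m) := by
  have hN0 : (0 : ℝ) < N := by exact_mod_cast hN
  -- Step 1: insert `h_t`
  have h1 : ∑ n ∈ Finset.Icc N (2 * N), (((w ((n : ℝ) / N)) ^ 2 : ℝ) : ℂ) * (n : ℂ) ^ ((t : ℂ) * I)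
      = (N : ℂ) ^ ((t : ℂ) * I) * ∑ n ∈ Finset.Icc N (2 * N), hFun w t ((n : ℝ) / N) := by
    rw [Finset.mul_sum]
    refine Finset.sum_congr rfl fun n hn ↦ ?_
    rw [Finset.mem_Icc] at hn
    exact weight_mul_cpow_eq t hN (le_trans hN hn.1)
  -- Step 2: the finite sum is the sum over all integers
  set s : Finset ℤ := (Finset.Icc N (2 * N)).map Nat.castEmbedding with hs
  have h2 : ∑ n ∈ Finset.Icc N (2 * N), hFun w t ((n : ℝ) / N) =
      ∑ n ∈ s, hFun w t ((n : ℝ) / N) := by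
    rw [hs, Finset.sum_map]
    simp
  have h3 : ∑' n : ℤ, hFun w t ((n : ℝ) / N) = ∑ n ∈ s, hFun w t ((n : ℝ) / N) := by
    apply tsum_eq_sum
    intro b hb
    apply hFun_eq_zero_of_notMem hsupp t
    intro hmem
    apply hb
    have hb1 : (N : ℝ) ≤ b := by have := hmem.1; rwa [le_div_iff₀ hN0, one_mul] at this
    have hb2 : (b : ℝ) ≤ 2 * N := by have := hmem.2; rwa [div_le_iff₀ hN0] at this
    have hb0 : 0 ≤ b := by exact_mod_cast (hN0.le.trans hb1)
    rw [hs, Finset.mem_map]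
    refine ⟨b.toNat, ?_, ?_⟩
    · rw [Finset.mem_Icc]
      constructor
      · have : (N : ℤ) ≤ b := by exact_mod_cast hb1
        omega
      · have : b ≤ 2 * (N : ℤ) := by exact_mod_cast hb2
        omega
    · simp [Int.toNat_of_nonneg hb0]
  rw [h1, h2, ← h3, tsum_hFun_eq_tsum_fourier hw hsupp t hN0, tsum_mul_left]
  push_cast
  ring

/-- Summability of `m ↦ ĥ_t(Nm)` over `ℤ` (`N > 0`), from Lemma 4.3 with `j = 2`.
[cite: GuthMaynard2026, Lemma 4.3] -/
theorem summable_fourier_hFun (hw : ContDiff ℝ ∞ w) (hsupp : Function.support w ⊆ Set.Icc 1 2)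
    (t : ℝ) {N : ℝ} (hN : 0 < N) : Summable fun m : ℤ ↦ 𝓕 (hFun w t) (N * m) := by
  obtain ⟨C, hC0, hC⟩ := norm_fourier_hFun_le_pow_div hw hsupp 2
  refine summable_of_isBigO (Real.summable_abs_int_rpow one_lt_two) ?_
  refine Asymptotics.IsBigO.of_bound (C * (1 + |t|) ^ 2 / N ^ 2) ?_
  rw [Filter.eventually_iff_exists_mem]
  refine ⟨{0}ᶜ, (Set.finite_singleton (0 : ℤ)).compl_mem_cofinite, fun m hm ↦ ?_⟩
  simp only [Set.mem_compl_iff, Set.mem_singleton_iff] at hm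
  have hm0 : (m : ℝ) ≠ 0 := by exact_mod_cast hm
  have hNm : N * m ≠ 0 := mul_ne_zero hN.ne' hm0
  have h1 := hC t (N * m) hNm
  rw [abs_mul, abs_of_pos hN, mul_pow] at h1
  rw [Real.norm_of_nonneg (Real.rpow_nonneg (abs_nonneg _) _), Real.rpow_neg (abs_nonneg _),
    show (2 : ℝ) = (2 : ℕ) by norm_num, Real.rpow_natCast]
  have hmpos : 0 < |(m : ℝ)| := abs_pos.mpr hm0
  calc ‖𝓕 (hFun w t) (N * m)‖ ≤ C * (1 + |t|) ^ 2 / (N ^ 2 * |(m : ℝ)| ^ 2) := h1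
    _ = C * (1 + |t|) ^ 2 / N ^ 2 * (|(m : ℝ)| ^ 2)⁻¹ := by field_simp

end weight

end GuthMaynardFourier

end Literature.NumberTheory.LFunctions
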